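import Summits.Parity.GeneralizedHardyLittlewood.Theorems.PrimeLevelFamEdgeMomentsBeyondDiagonalDiagDecorTools
import Mathlib.Data.Finset.NatDivisors
import Mathlib.Algebra.Squarefree.Basic
import HarnessLib

/-!
# Route `PrimeLevelFamEdge`, crux K_A `MomentsBeyondDiagonal` (stmt-Parity-20007), line «petersson_layers» v4, stub `stub_diag`:
# **the divisor-log sums `τ_{α,β}` over coprime products, and `τ_{1,1}` on squarefree numbers (census R3(ii), analytic half)**

The log-decorated Selberg coordinates (`…DiagLineDecorated`) carry the divisor-log sums
`τ_{α,β}(k) = Σ_{d∣k}(log d)^α(log(k/d))^β` on squarefree `k`. This file gives the multiplicativity tool and the first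
non-trivial closed form:

* `sum_divisors_mul_eq_sum_sum_of_coprime` — **for coprime `m, n ≥ 1` and any `F`,
  `Σ_{d∣mn} F(d, mn/d) = Σ_{a∣m}Σ_{b∣n} F(ab, (m/a)(n/b))`** (Mathlib's `Nat.divisors_mul` + `Nat.Coprime.mul_injOn_divisors`);
* `tau11_mul_of_coprime` — `T(mn) = τ(n)T(m) + τ(m)T(n) + ½τ(m)τ(n)·log m·log n` for coprime `m, n`, `T = τ_{1,1}`;
* `tau11_eq_of_squarefree` — **for squarefree `k`: `Σ_{d∣k} log d·log(k/d) = τ(k)·((log k)² − Σ_{p∣k}(log p)²)/4`**,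
  i.e. `τ_{1,1} = τ·(log² − P₂)/4` with the additive prime decoration `P₂(k) = Σ_{p∣k} log²p` (removable by
  `…DiagDecorTools.sum_mul_sum_primeFactors_eq`).

Def-free; theorems only. Helper `--supports stmt-Parity-20007`; closes nothing; K_A, K_B and the Parity summit are NOT
proved; nothing about Landau–Siegel zeros.

## References
* E. Kowalski, P. Michel, J. VanderKam, J. reine angew. Math. 526 (2000), (23)–(28) pp. 13–15.
  [cite: KowalskiMichelVanderKam2000, (23)–(28) — derivation (bookkeeping of log-decorations)]
-/

noncomputable section

open Finset

namespace Summit.Parity.GeneralizedHardyLittlewood.Theorems.MomentsBeyondDiagonal.DiagLines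

/-- **Divisors of a coprime product, two-variable weighted form**: for coprime `m, n ≥ 1` and any `F`,
`Σ_{d∣mn} F(d, mn/d) = Σ_{a∣m}Σ_{b∣n} F(ab, (m/a)(n/b))`. [folklore] -/
theorem sum_divisors_mul_eq_sum_sum_of_coprime {M : Type*} [AddCommMonoid M] {m n : ℕ} (hmn : m.Coprime n)
    (F : ℕ → ℕ → M) :
    ∑ d ∈ (m * n).divisors, F d (m * n / d) = ∑ a ∈ m.divisors, ∑ b ∈ n.divisors, F (a * b) (m / a * (n / b)) := by
  rw [Nat.divisors_mul, ← Finset.image_mul_product, Finset.sum_image hmn.mul_injOn_divisors, Finset.sum_product]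
  refine Finset.sum_congr rfl fun a ha ↦ Finset.sum_congr rfl fun b hb ↦ ?_
  have ha' := (Nat.mem_divisors.1 ha).1
  have hb' := (Nat.mem_divisors.1 hb).1
  show F (a * b) (m * n / (a * b)) = F (a * b) (m / a * (n / b))
  rw [Nat.div_mul_div_comm ha' hb']

/-- **`τ_{1,1}` over a coprime product**: for coprime `m, n ≥ 1`, with `T(k) = Σ_{d∣k} log d·log(k/d)` and `τ(k) = #div k`,
`T(mn) = τ(n)·T(m) + τ(m)·T(n) + ½·τ(m)τ(n)·log m·log n`. [folklore] -/
theorem tau11_mul_of_coprime {m n : ℕ} (hm : m ≠ 0) (hn : n ≠ 0) (hmn : m.Coprime n) :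
    ∑ d ∈ (m * n).divisors, Real.log d * Real.log ((m * n / d : ℕ) : ℝ) =
      (n.divisors.card : ℝ) * ∑ a ∈ m.divisors, Real.log a * Real.log ((m / a : ℕ) : ℝ) +
        (m.divisors.card : ℝ) * ∑ b ∈ n.divisors, Real.log b * Real.log ((n / b : ℕ) : ℝ) +
        (m.divisors.card : ℝ) * (n.divisors.card : ℝ) * Real.log m * Real.log n / 2 := by
  rw [sum_divisors_mul_eq_sum_sum_of_coprime hmn (fun d e ↦ Real.log d * Real.log (e : ℝ))]
  -- expand `log(ab)·log((m/a)(n/b))`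
  have hexp : ∀ a ∈ m.divisors, ∀ b ∈ n.divisors,
      Real.log ((a * b : ℕ) : ℝ) * Real.log ((m / a * (n / b) : ℕ) : ℝ) =
        Real.log a * Real.log ((m / a : ℕ) : ℝ) + Real.log b * Real.log ((n / b : ℕ) : ℝ) +
          Real.log a * Real.log ((n / b : ℕ) : ℝ) + Real.log b * Real.log ((m / a : ℕ) : ℝ) := by
    intro a ha b hb
    have ha' := (Nat.mem_divisors.1 ha).1
    have hb' := (Nat.mem_divisors.1 hb).1
    have ha0 : a ≠ 0 := by rintro rfl; exact hm (zero_dvd_iff.1 ha')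
    have hb0 : b ≠ 0 := by rintro rfl; exact hn (zero_dvd_iff.1 hb')
    have hma : m / a ≠ 0 := (Nat.div_ne_zero_iff_of_dvd ha').2 ⟨hm, ha0⟩
    have hnb : n / b ≠ 0 := (Nat.div_ne_zero_iff_of_dvd hb').2 ⟨hn, hb0⟩
    push_cast
    rw [Real.log_mul (by exact_mod_cast ha0) (by exact_mod_cast hb0),
      Real.log_mul (by exact_mod_cast hma) (by exact_mod_cast hnb)]
    ring
  rw [Finset.sum_congr rfl fun a ha ↦ Finset.sum_congr rfl fun b hb ↦ hexp a ha b hb]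
  simp only [Finset.sum_add_distrib]
  -- the four pieces
  have h1 : ∑ a ∈ m.divisors, ∑ b ∈ n.divisors, Real.log a * Real.log ((m / a : ℕ) : ℝ) =
      (n.divisors.card : ℝ) * ∑ a ∈ m.divisors, Real.log a * Real.log ((m / a : ℕ) : ℝ) := by
    rw [Finset.mul_sum]
    refine Finset.sum_congr rfl fun a _ ↦ ?_
    rw [Finset.sum_const, nsmul_eq_mul]
  have h2 : ∑ a ∈ m.divisors, ∑ b ∈ n.divisors, Real.log b * Real.log ((n / b : ℕ) : ℝ) =
      (m.divisors.card : ℝ) * ∑ b ∈ n.divisors, Real.log b * Real.log ((n / b : ℕ) : ℝ) := by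
    rw [Finset.sum_const, nsmul_eq_mul]
  have hA : ∑ a ∈ m.divisors, Real.log ((m / a : ℕ) : ℝ) = ∑ a ∈ m.divisors, Real.log (a : ℝ) :=
    Nat.sum_div_divisors m (fun a ↦ Real.log (a : ℝ))
  have hB : ∑ b ∈ n.divisors, Real.log ((n / b : ℕ) : ℝ) = ∑ b ∈ n.divisors, Real.log (b : ℝ) :=
    Nat.sum_div_divisors n (fun b ↦ Real.log (b : ℝ))
  have h3 : ∑ a ∈ m.divisors, ∑ b ∈ n.divisors, Real.log a * Real.log ((n / b : ℕ) : ℝ) =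
      (∑ a ∈ m.divisors, Real.log (a : ℝ)) * ∑ b ∈ n.divisors, Real.log (b : ℝ) := by
    rw [← hB, Finset.sum_mul_sum]
  have h4 : ∑ a ∈ m.divisors, ∑ b ∈ n.divisors, Real.log b * Real.log ((m / a : ℕ) : ℝ) =
      (∑ a ∈ m.divisors, Real.log (a : ℝ)) * ∑ b ∈ n.divisors, Real.log (b : ℝ) := by
    rw [← hA, Finset.sum_mul]
    refine Finset.sum_congr rfl fun a _ ↦ ?_
    rw [Finset.mul_sum]
    exact Finset.sum_congr rfl fun b _ ↦ by ring
  rw [h1, h2, h3, h4, sum_divisors_log_eq hm, sum_divisors_log_eq hn]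
  ring

/-- `τ_{1,1}(p) = 0` for a prime `p` (divisors `1, p`). [folklore] -/
theorem tau11_prime {p : ℕ} (hp : p.Prime) :
    ∑ d ∈ p.divisors, Real.log d * Real.log ((p / d : ℕ) : ℝ) = 0 := by
  rw [hp.divisors, Finset.sum_pair hp.one_lt.ne]
  simp [Nat.div_self hp.pos]

/-- **`τ_{1,1}` on squarefree numbers**: for squarefree `k`,
`Σ_{d∣k} log d·log(k/d) = τ(k)·((log k)² − Σ_{p∣k}(log p)²)/4`. [folklore] -/
theorem tau11_eq_of_squarefree {k : ℕ} (hk : Squarefree k) :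
    ∑ d ∈ k.divisors, Real.log d * Real.log ((k / d : ℕ) : ℝ) =
      (k.divisors.card : ℝ) * (Real.log k ^ 2 - ∑ p ∈ k.primeFactors, Real.log p ^ 2) / 4 := by
  induction k using Nat.recOnPosPrimePosCoprime with
  | zero => exact absurd hk not_squarefree_zero
  | one => simp
  | prime_pow p n hp hn =>
    -- squarefree prime power: `n = 1`
    have hn1 : n = 1 := by
      have h := (Nat.squarefree_pow_iff hp.ne_one hn.ne').1 hk
      exact h.2
    subst hn1
    rw [pow_one, tau11_prime hp, hp.divisors, Finset.card_pair hp.one_lt.ne, hp.primeFactors,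
      Finset.sum_singleton]
    ring
  | coprime a b ha hb hab iha ihb =>
    have hsq := Nat.squarefree_mul_iff.1 hk
    have ha0 : a ≠ 0 := by omega
    have hb0 : b ≠ 0 := by omega
    rw [tau11_mul_of_coprime ha0 hb0 hab, iha hsq.2.1, ihb hsq.2.2, Nat.Coprime.card_divisors_mul hab,
      Nat.Coprime.primeFactors_mul hab, Finset.sum_union (Nat.Coprime.disjoint_primeFactors hab)]
    push_cast
    rw [Real.log_mul (by exact_mod_cast ha0) (by exact_mod_cast hb0)]
    ring

end Summit.Parity.GeneralizedHardyLittlewood.Theorems.MomentsBeyondDiagonal.DiagLines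

end
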